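import Literature.Analysis.FunctionSpaces.MultiscaleBakryEmery
import Mathlib.LinearAlgebra.Matrix.Trace
import HarnessLib

/-!
# The Bochner formula behind the multiscale Bakry–Émery criterion: pointwise algebra
# (Bauerschmidt–Bodineau–Dagallier, Lemma 1 and the inequality `(L_s − ∂_s)(∇√F_s)²_{Ċ_s} ≥ 2λ̇_s(∇√F_s)²_{Ċ_s}`)

Topic `Literature/Analysis/FunctionSpaces`; "proof architecture" file behind the named fact
`Polchinski.BauerschmidtBodineau_multiscaleBakryEmery` ([BBD] Theorem 3, `MultiscaleBakryEmery.lean`).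
[BBD] prove Theorem 3 from the entropy production formula (e:dEnt) and the key estimate
(eq: exp decay exchanged gradient), itself obtained from **Lemma 1** (p0016 L100–110, proof p0017 L22–60):
with `F = P_{0,t}F`, `L_t = ½Δ_{Ċ_t} − (∇V_t, ∇·)_{Ċ_t}`,
`(L_t − ∂_t)(∇√F)²_Q = 2(∇√F, Hess V_t Ċ_t ∇√F)_Q + ¼ F |Ċ_t^{1/2} (Hess log F) Q^{1/2}|₂²`, via the
«Bochner formula» `(L_t − ∂_t)(∇F)²_Q = 2(∇F, Hess V_t Ċ_t ∇F)_Q + |Ċ_t^{1/2} Hess F Q^{1/2}|₂²` and the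
quotient rule (display p0017 L30–38); applied with `Q = Ċ_s` (extra term `−(∇√F)²_{C̈_s}`, p0016 L113–118)
and combined with the multiscale assumption (e:assCt-mon) it gives
`(L_s − ∂_s)(∇√P_{0,s}F)²_{Ċ_s} ≥ 2λ̇_s (∇√P_{0,s}F)²_{Ċ_s}` (p0016 L120–123).

This file isolates the POINTWISE ALGEBRA of that computation, with no analysis: at a fixed point, the
value `u > 0` of `F_s`, its gradient `g`, Hessian `M`, third derivative `T`, the gradient `p` and Hessian
`R` of `V_s`, the matrices `Ċ` (positive semidefinite) and `C̈`, and the time derivatives `u̇`, `ġ` are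
real numbers / arrays subject only to the two generator identities
`u̇ = ½Σ Ċ_{ij} M_{ij} − Σ Ċ_{ij} p_i g_j` ([BBD] Prop 8, `∂_tF_t = L_tF_t`) and its spatial gradient
`ġ_k = ½Σ Ċ_{ij} T_{ijk} − Σ Ċ_{ij}(R_{ik} g_j + p_i M_{jk})`; the conclusion is the inequality
`2λ̇ H ≤ L H − Ḣ` for `H = (∇u)²_{Ċ}/(4u) = (∇√u)²_{Ċ}`, where `L H`, `Ḣ` are the explicit second-order
expressions.  The analytic identification of these quantities with the derivatives of the Polchinski
semigroup is done in the companion files; the second part of this file records the corresponding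
identities for the "jets" `W = E_{C_t}[e^{−V₀}F(·+ζ)]`, `Z = E_{C_t}[e^{−V₀}(·+ζ)]` and their derivatives
(`F_t = W/Z`, [BBD] proof of Prop 8 p0015 L9–32), i.e. the two generator identities in quotient form.

## Main results (sorry-free; no new definitions, no new named facts)

* `trace_mul_mul_mul_self_nonneg` — `0 ≤ tr(Ċ X Ċ X)` for `Ċ ⪰ 0` and `X` symmetric (the Frobenius
  norm `|Ċ^{1/2} X Ċ^{1/2}|₂² ≥ 0` of Lemma 1).
* `bochner_sqrt_ineq` — **[BBD] Lemma 1 + (e:assCt-mon) ⟹ `(L_s − ∂_s)(∇√F_s)²_{Ċ_s} ≥ 2λ̇_s(∇√F_s)²_{Ċ_s}`**,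
  pointwise algebraic form.
* `jet_generator`, `jet_gradient_generator` — the generator identity `u̇ = L u` and its gradient
  `ġ = ∇(L u)` for `u = W/Z` in terms of the smoothed jets of `W`, `Z` (heat equations `Ẇ = ½Δ_{Ċ}W`,
  `Ż = ½Δ_{Ċ}Z`).

Nothing here concerns Yang–Mills.

## References

* [BauerschmidtBodineauDagallier2023] R. Bauerschmidt, T. Bodineau, B. Dagallier, Probab. Surveys 21
  (2024) 200–290, arXiv:2307.07619 — Lemma 1 p0016 L100–123, proof p0017 L22–60; Prop 8 proof p0015.
  READ (held text `paper:arxiv-2307.07619`).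
* [BauerschmidtBodineau2021SineGordonLSI] R. Bauerschmidt, T. Bodineau, CPAM 74 (2021) §2.2–2.3 (the
  same computation, «for a more detailed proof»).
-/

noncomputable section

open Finset
open scoped Matrix MatrixOrder

namespace Literature.Analysis.FunctionSpaces

namespace Polchinski

variable {n : Type*} [Fintype n]

/-! ### Reordering of iterated finite sums (helpers) -/

/-- Reversal of three nested finite sums. [folklore] -/
private theorem sum_rev₃ {α : Type*} [AddCommMonoid α] (f : n → n → n → α) :
    ∑ a, ∑ b, ∑ c, f a b c = ∑ c, ∑ b, ∑ a, f a b c := by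
  calc ∑ a, ∑ b, ∑ c, f a b c = ∑ a, ∑ c, ∑ b, f a b c :=
        sum_congr rfl fun _ _ => Finset.sum_comm
    _ = ∑ c, ∑ a, ∑ b, f a b c := Finset.sum_comm
    _ = ∑ c, ∑ b, ∑ a, f a b c := sum_congr rfl fun c _ => Finset.sum_comm

/-- Swap of the two inner sums of a triple sum. [folklore] -/
private theorem sum_swap₂₃ {α : Type*} [AddCommMonoid α] (f : n → n → n → α) :
    ∑ a, ∑ b, ∑ c, f a b c = ∑ a, ∑ c, ∑ b, f a b c :=
  sum_congr rfl fun _ _ => Finset.sum_comm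

/-- A double sum of products of separated factors is the product of the sums. [folklore] -/
private theorem sum_sum_mul_eq_mul_sum {α : Type*} [CommSemiring α] (a b : n → α) :
    ∑ i, ∑ j, a i * b j = (∑ i, a i) * ∑ j, b j := by
  rw [Finset.sum_mul]
  refine sum_congr rfl fun i _ => ?_
  rw [Finset.mul_sum]

/-! ### The Frobenius term of Lemma 1: `tr(Ċ X Ċ X) ≥ 0` -/

/-- For a real symmetric matrix `Y`, `tr(Y Y) = Σ_{ij} Y_{ij}² ≥ 0`. [folklore] -/
private theorem trace_mul_self_nonneg_of_symm {Y : Matrix n n ℝ} (hY : ∀ i j, Y j i = Y i j) :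
    0 ≤ Matrix.trace (Y * Y) := by
  simp only [Matrix.trace, Matrix.diag, Matrix.mul_apply]
  refine sum_nonneg fun i _ => sum_nonneg fun j _ => ?_
  rw [hY i j]
  exact mul_self_nonneg _

/-- **The Frobenius term of [BBD] Lemma 1**: for `Ċ` positive semidefinite and `X` symmetric (real
matrices), `tr(Ċ X Ċ X) = |Ċ^{1/2} X Ċ^{1/2}|₂² ≥ 0`.  Proof: `Ċ = S S` with `S = Ċ^{1/2}` symmetric
(continuous functional calculus), `tr(SSXSSX) = tr((SXS)(SXS))` by cyclicity, and `SXS` is symmetric.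
[cite: BauerschmidtBodineauDagallier2023, Lemma 1] -/
theorem trace_mul_mul_mul_self_nonneg [DecidableEq n] {C X : Matrix n n ℝ} (hC : C.PosSemidef)
    (hX : ∀ i j, X j i = X i j) : 0 ≤ Matrix.trace (C * X * C * X) := by
  have hC0 : (0 : Matrix n n ℝ) ≤ C := Matrix.nonneg_iff_posSemidef.2 hC
  set S : Matrix n n ℝ := CFC.sqrt C with hS
  have hSS : S * S = C := CFC.sqrt_mul_sqrt_self C hC0
  have hSsa : IsSelfAdjoint S := (CFC.sqrt_nonneg C).isSelfAdjoint
  have hSherm : S.IsHermitian := hSsa.isHermitian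
  have hST : Sᵀ = S := by
    have h := hSherm.eq
    rwa [Matrix.conjTranspose_eq_transpose_of_trivial] at h
  have hXT : Xᵀ = X := by
    ext i j
    rw [Matrix.transpose_apply]
    exact hX i j
  -- `Y = S X S` is symmetric
  have hYT : (S * X * S)ᵀ = S * X * S := by
    rw [Matrix.transpose_mul, Matrix.transpose_mul, hST, hXT, Matrix.mul_assoc]
  have hYsym : ∀ i j, (S * X * S) j i = (S * X * S) i j := fun i j => by
    have h := congrFun (congrFun hYT i) j
    rw [Matrix.transpose_apply] at h
    exact h
  -- cyclicity
  have hcyc : Matrix.trace (C * X * C * X) = Matrix.trace ((S * X * S) * (S * X * S)) := by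
    rw [← hSS]
    calc Matrix.trace (S * S * X * (S * S) * X)
        = Matrix.trace (S * (S * X * S * S * X)) := by
          simp only [Matrix.mul_assoc]
      _ = Matrix.trace ((S * X * S * S * X) * S) := Matrix.trace_mul_comm _ _
      _ = Matrix.trace ((S * X * S) * (S * X * S)) := by
          simp only [Matrix.mul_assoc]
  rw [hcyc]
  exact trace_mul_self_nonneg_of_symm hYsym

/-- Coordinate form of `trace_mul_mul_mul_self_nonneg`:
`0 ≤ Σ_{ijkl} Ċ_{ij} X_{jk} Ċ_{kl} X_{li}`. [cite: BauerschmidtBodineauDagallier2023, Lemma 1] -/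
theorem sum_mul_mul_mul_nonneg [DecidableEq n] {C X : Matrix n n ℝ} (hC : C.PosSemidef)
    (hX : ∀ i j, X j i = X i j) :
    0 ≤ ∑ i, ∑ j, ∑ k, ∑ l, C i j * X j k * C k l * X l i := by
  have h := trace_mul_mul_mul_self_nonneg hC hX
  have he : Matrix.trace (C * X * C * X) = ∑ i, ∑ l, ∑ k, ∑ j, C i j * X j k * C k l * X l i := by
    simp only [Matrix.trace, Matrix.diag, Matrix.mul_apply, Finset.sum_mul]
  rw [he] at h
  have he' : ∑ i, ∑ l, ∑ k, ∑ j, C i j * X j k * C k l * X l i =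
      ∑ i, ∑ j, ∑ k, ∑ l, C i j * X j k * C k l * X l i :=
    sum_congr rfl fun i _ => sum_rev₃ fun l k j => C i j * X j k * C k l * X l i
  rwa [he'] at h

/-! ### Coordinate sums versus matrix operations (helpers) -/

/-- `Σ_{ij} C_{ij} a_i b_j = a · (C b)`. [folklore] -/
private theorem sum_sum_mul_mul_eq_dotProduct_mulVec (C : Matrix n n ℝ) (a b : n → ℝ) :
    ∑ i, ∑ j, C i j * (a i * b j) = a ⬝ᵥ (C *ᵥ b) := by
  simp only [dotProduct, Matrix.mulVec, Finset.mul_sum]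
  refine sum_congr rfl fun i _ => sum_congr rfl fun j _ => ?_
  ring

/-- `Σ_{ij} C_{ij} X_{ji} = tr(C X)`. [folklore] -/
private theorem sum_sum_mul_eq_trace_mul (C X : Matrix n n ℝ) :
    ∑ i, ∑ j, C i j * X j i = Matrix.trace (C * X) := by
  simp only [Matrix.trace, Matrix.diag, Matrix.mul_apply]

/-- `Σ_k (Σ_l C_{kl} b_l) c_k = (C b) · c`. [folklore] -/
private theorem sum_sum_mul_mul_eq_mulVec_dotProduct (C : Matrix n n ℝ) (b c : n → ℝ) :
    ∑ k, ∑ l, C k l * (c k * b l) = (C *ᵥ b) ⬝ᵥ c := by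
  simp only [dotProduct, Matrix.mulVec, Finset.sum_mul]
  refine sum_congr rfl fun k _ => sum_congr rfl fun l _ => ?_
  ring

/-- For symmetric `C`: `v ᵥ* C = C *ᵥ v`. [folklore] -/
private theorem vecMul_eq_mulVec_of_transpose_eq {C : Matrix n n ℝ} (hCT : Cᵀ = C) (v : n → ℝ) :
    v ᵥ* C = C *ᵥ v := by
  rw [← Matrix.mulVec_transpose, hCT]

/-- For symmetric `C`: `a · (C b) = (C a) · b`. [folklore] -/
private theorem dotProduct_mulVec_symm {C : Matrix n n ℝ} (hCT : Cᵀ = C) (a b : n → ℝ) :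
    a ⬝ᵥ (C *ᵥ b) = (C *ᵥ a) ⬝ᵥ b := by
  rw [Matrix.dotProduct_mulVec, vecMul_eq_mulVec_of_transpose_eq hCT]

/-! ### [BBD] Lemma 1 with the multiscale assumption: the pointwise inequality -/

/-- **[BBD] Lemma 1 combined with the multiscale Bakry–Émery assumption — pointwise algebraic form.**
At a point, let `u > 0` be the value of `F_s = P_{0,s}F`, `g = ∇F_s`, `M = Hess F_s` (symmetric),
`T_k = Hess(∂_kF_s)`, `p = ∇V_s`, `R_{ik} = ∂_k∂_iV_s`, `Ċ = Ċ_s ⪰ 0` (symmetric), `C̈ = C̈_s`, and let the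
time derivatives `u̇ = ∂_sF_s`, `ġ = ∂_s∇F_s` satisfy the generator identity `u̇ = L_sF_s =
½Σ Ċ_{ij}∂_i∂_jF_s − Σ Ċ_{ij} ∂_iV_s ∂_jF_s` ([BBD] Prop 8) and its spatial gradient
`ġ_k = ½Σ Ċ_{ij}∂_i∂_j∂_kF_s − Σ Ċ_{ij}(∂_k∂_iV_s ∂_jF_s + ∂_iV_s ∂_j∂_kF_s)`.  With
`H = (∇F_s)²_{Ċ}/(4F_s) = (∇√F_s)²_{Ċ_s}`, `L H = ½Σ Ċ_{ij}∂_i∂_jH − Σ Ċ_{ij}∂_iV_s∂_jH` and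
`Ḣ = ∂_sH` (all expanded by the product and quotient rules, the `s`-dependence of `Ċ_s` contributing
`(∇F_s)²_{C̈_s}/(4F_s)`), the multiscale assumption `Ċ Hess V_s Ċ − ½C̈ ≥ λ̇ Ċ` tested on `∇F_s`
gives `(L − ∂_s) H ≥ 2λ̇ H` ([BBD] p0016 L113–123: Lemma 1 with `Q = Ċ_s`, the Frobenius term
`¼F_s|Ċ^{1/2} Hess log F_s Ċ^{1/2}|₂² ≥ 0` being dropped).
[cite: BauerschmidtBodineauDagallier2023, Lemma 1] -/
theorem bochner_sqrt_ineq [DecidableEq n] {C Cdd M R : Matrix n n ℝ} (hC : C.PosSemidef)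
    (hCT : Cᵀ = C) (hMT : Mᵀ = M) {g p gd : n → ℝ} {T : n → n → n → ℝ} {u ud lam : ℝ}
    (hu : 0 < u)
    (h1 : ud = (1 / 2) * (∑ i, ∑ j, C i j * M j i) - ∑ i, ∑ j, C i j * (p i * g j))
    (h2 : ∀ k, gd k = (1 / 2) * (∑ i, ∑ j, C i j * T k i j) -
      ∑ i, ∑ j, C i j * (R i k * g j + p i * M j k))
    (hms : lam * (g ⬝ᵥ (C *ᵥ g)) ≤
      (C *ᵥ g) ⬝ᵥ (R *ᵥ (C *ᵥ g)) - (1 / 2) * (g ⬝ᵥ (Cdd *ᵥ g)))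
    {A H LH Hd Ad : ℝ} {dA dH : n → ℝ} {d2A d2H U2 : n → n → ℝ}
    (hA : A = ∑ k, ∑ l, C k l * (g k * g l))
    (hdA : ∀ j, dA j = ∑ k, ∑ l, C k l * (g k * M l j + g l * M k j))
    (hd2A : ∀ i j, d2A i j =
      ∑ k, ∑ l, C k l * (g k * T l i j + M k i * M l j + (g l * T k i j + M l i * M k j)))
    (hU2 : ∀ i j, U2 i j = M j i)
    (hH : H = A / (4 * u))
    (hdH : ∀ j, dH j = dA j / (4 * u) - A * g j / (4 * u ^ 2))
    (hd2H : ∀ i j, d2H i j = d2A i j / (4 * u) - (dA j * g i + dA i * g j) / (4 * u ^ 2) -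
      A * U2 i j / (4 * u ^ 2) + 2 * A * (g i * g j) / (4 * u ^ 3))
    (hLH : LH = (1 / 2) * (∑ i, ∑ j, C i j * d2H i j) - ∑ i, ∑ j, C i j * (p i * dH j))
    (hAd : Ad = 2 * (∑ k, ∑ l, C k l * (gd k * g l)) + ∑ k, ∑ l, Cdd k l * (g k * g l))
    (hHd : Hd = Ad / (4 * u) - A * ud / (4 * u ^ 2)) :
    2 * lam * H ≤ LH - Hd := by
  -- matrix abbreviations
  set w : n → ℝ := C *ᵥ g with hw
  have hMsym : ∀ i j, M j i = M i j := fun i j => by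
    have h := congrFun (congrFun hMT i) j
    rwa [Matrix.transpose_apply] at h
  have hCsym : ∀ i j, C j i = C i j := fun i j => by
    have h := congrFun (congrFun hCT i) j
    rwa [Matrix.transpose_apply] at h
  have hgC : g ᵥ* C = w := vecMul_eq_mulVec_of_transpose_eq hCT g
  -- (1) `A = g·w`
  have hA' : A = g ⬝ᵥ w := by rw [hA, sum_sum_mul_mul_eq_dotProduct_mulVec]
  -- (2) `dA = 2 M w`
  have hdA' : ∀ j, dA j = 2 * (M *ᵥ w) j := by
    intro j
    rw [hdA j]
    have e1 : ∑ k, ∑ l, C k l * (g k * M l j + g l * M k j) =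
        (∑ k, ∑ l, C k l * (g k * M l j)) + ∑ k, ∑ l, C k l * (M k j * g l) := by
      rw [← Finset.sum_add_distrib]
      refine sum_congr rfl fun k _ => ?_
      rw [← Finset.sum_add_distrib]
      refine sum_congr rfl fun l _ => ?_
      ring
    have e2 : ∑ k, ∑ l, C k l * (g k * M l j) = (g ᵥ* C) ⬝ᵥ (fun l => M l j) := by
      simp only [dotProduct, Matrix.vecMul, Finset.sum_mul]
      rw [Finset.sum_comm]
      refine sum_congr rfl fun k _ => sum_congr rfl fun l _ => ?_
      ring
    have e3 : ∑ k, ∑ l, C k l * (M k j * g l) = (C *ᵥ g) ⬝ᵥ (fun k => M k j) := by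
      rw [sum_sum_mul_mul_eq_mulVec_dotProduct]
    have e4 : (M *ᵥ w) j = w ⬝ᵥ (fun l => M l j) := by
      simp only [Matrix.mulVec, dotProduct]
      refine sum_congr rfl fun l _ => ?_
      rw [hMsym j l]; ring
    rw [e1, e2, e3, hgC, e4]
    ring
  -- (3) `Σ C_{kl}(g_k T_l ij + g_l T_k ij) = 2 Σ_k w_k T_k i j`
  have hTw : ∀ i j, ∑ k, ∑ l, C k l * (g k * T l i j + g l * T k i j) = 2 * ∑ k, w k * T k i j := by
    intro i j
    have e1 : ∑ k, ∑ l, C k l * (g k * T l i j + g l * T k i j) =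
        (∑ k, ∑ l, C k l * (g k * T l i j)) + ∑ k, ∑ l, C k l * (T k i j * g l) := by
      rw [← Finset.sum_add_distrib]
      refine sum_congr rfl fun k _ => ?_
      rw [← Finset.sum_add_distrib]
      refine sum_congr rfl fun l _ => ?_
      ring
    have e2 : ∑ k, ∑ l, C k l * (g k * T l i j) = (g ᵥ* C) ⬝ᵥ (fun l => T l i j) := by
      simp only [dotProduct, Matrix.vecMul, Finset.sum_mul]
      rw [Finset.sum_comm]
      refine sum_congr rfl fun k _ => sum_congr rfl fun l _ => ?_
      ring
    have e3 : ∑ k, ∑ l, C k l * (T k i j * g l) = (C *ᵥ g) ⬝ᵥ (fun k => T k i j) := by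
      rw [sum_sum_mul_mul_eq_mulVec_dotProduct]
    rw [e1, e2, e3, hgC, ← hw]
    simp only [dotProduct]
    rw [two_mul]
  -- (4) `Σ C_{kl}(M_ki M_lj + M_li M_kj) = 2 (M C M)_{ij}`
  have hMCM : ∀ i j, ∑ k, ∑ l, C k l * (M k i * M l j + M l i * M k j) = 2 * (M * C * M) i j := by
    intro i j
    have e0 : (M * C * M) i j = ∑ k, ∑ l, M i k * C k l * M l j := by
      simp only [Matrix.mul_apply, Finset.sum_mul]
      rw [Finset.sum_comm]
    have e0' : (M * C * M) j i = ∑ k, ∑ l, M j k * C k l * M l i := by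
      simp only [Matrix.mul_apply, Finset.sum_mul]
      rw [Finset.sum_comm]
    have hsymMCM : (M * C * M) j i = (M * C * M) i j := by
      have ht : (M * C * M)ᵀ = M * C * M := by
        rw [Matrix.transpose_mul, Matrix.transpose_mul, hMT, hCT, Matrix.mul_assoc]
      have h := congrFun (congrFun ht i) j
      rwa [Matrix.transpose_apply] at h
    have e1 : ∑ k, ∑ l, C k l * (M k i * M l j + M l i * M k j) =
        (∑ k, ∑ l, M i k * C k l * M l j) + ∑ k, ∑ l, M j k * C k l * M l i := by
      rw [← Finset.sum_add_distrib]
      refine sum_congr rfl fun k _ => ?_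
      rw [← Finset.sum_add_distrib]
      refine sum_congr rfl fun l _ => ?_
      rw [hMsym i k, hMsym j k]; ring
    rw [e1, ← e0, ← e0', hsymMCM, two_mul]
  -- (5) `½ Σ_{ij} C_{ij} d2A_{ij} = Θ + tr(C M C M)` with `Θ = Σ_k w_k Σ_{ij} C_{ij} T_k i j`
  have hd2A' : ∀ i j, d2A i j = 2 * (∑ k, w k * T k i j) + 2 * (M * C * M) i j := by
    intro i j
    rw [hd2A i j, ← hTw i j, ← hMCM i j, ← Finset.sum_add_distrib]
    refine sum_congr rfl fun k _ => ?_
    rw [← Finset.sum_add_distrib]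
    refine sum_congr rfl fun l _ => ?_
    ring
  have hMCMsym : ∀ i j, (M * C * M) j i = (M * C * M) i j := by
    have ht : (M * C * M)ᵀ = M * C * M := by
      rw [Matrix.transpose_mul, Matrix.transpose_mul, hMT, hCT, Matrix.mul_assoc]
    intro i j
    have h := congrFun (congrFun ht i) j
    rwa [Matrix.transpose_apply] at h
  have hST : ∑ i, ∑ j, C i j * (∑ k, w k * T k i j) = ∑ k, w k * ∑ i, ∑ j, C i j * T k i j := by
    simp only [Finset.mul_sum]
    rw [sum_rev₃ fun i j k => C i j * (w k * T k i j)]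
    refine sum_congr rfl fun k _ => ?_
    rw [Finset.sum_comm]
    refine sum_congr rfl fun i _ => sum_congr rfl fun j _ => ?_
    ring
  have hSM : ∑ i, ∑ j, C i j * (M * C * M) i j = Matrix.trace (C * (M * C * M)) := by
    rw [← sum_sum_mul_eq_trace_mul]
    refine sum_congr rfl fun i _ => sum_congr rfl fun j _ => ?_
    rw [hMCMsym i j]
  have hLA1 : (1 / 2) * (∑ i, ∑ j, C i j * d2A i j) =
      (∑ k, w k * ∑ i, ∑ j, C i j * T k i j) + Matrix.trace (C * (M * C * M)) := by
    have e0 : ∀ i j, C i j * d2A i j =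
        2 * (C i j * (∑ k, w k * T k i j)) + 2 * (C i j * (M * C * M) i j) := by
      intro i j; rw [hd2A' i j]; ring
    have e1 : ∑ i, ∑ j, C i j * d2A i j =
        2 * (∑ i, ∑ j, C i j * (∑ k, w k * T k i j)) + 2 * ∑ i, ∑ j, C i j * (M * C * M) i j := by
      simp_rw [e0, Finset.sum_add_distrib, ← Finset.mul_sum]
    rw [e1, hST, hSM]
    ring
  -- (6) `Σ C_{ij} p_i dA_j = 2 (M(Cp))·w`
  have hpdA : ∑ i, ∑ j, C i j * (p i * dA j) = 2 * ((M *ᵥ (C *ᵥ p)) ⬝ᵥ w) := by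
    have e1 : ∑ i, ∑ j, C i j * (p i * dA j) = p ⬝ᵥ (C *ᵥ dA) :=
      sum_sum_mul_mul_eq_dotProduct_mulVec C p dA
    have e2 : dA = fun j => 2 * (M *ᵥ w) j := funext hdA'
    have e3 : (fun j => 2 * (M *ᵥ w) j) = (2 : ℝ) • (M *ᵥ w) := by
      funext j; simp [Pi.smul_apply, smul_eq_mul]
    rw [e1, e2, e3, Matrix.mulVec_smul, dotProduct_smul, smul_eq_mul,
      dotProduct_mulVec_symm hCT, dotProduct_mulVec_symm hMT]
  -- (7) the `T`-part of `Ad`: `Σ C_{kl} gd_k g_l = gd · w`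
  have hgdw : ∑ k, ∑ l, C k l * (gd k * g l) = gd ⬝ᵥ w :=
    sum_sum_mul_mul_eq_dotProduct_mulVec C gd g
  have hgd' : ∀ k, gd k = (1 / 2) * (∑ i, ∑ j, C i j * T k i j) -
      ((w ᵥ* R) k + (M *ᵥ (C *ᵥ p)) k) := by
    intro k
    rw [h2 k]
    congr 1
    have e1 : ∑ i, ∑ j, C i j * (R i k * g j + p i * M j k) =
        (∑ i, ∑ j, C i j * (R i k * g j)) + ∑ i, ∑ j, C i j * (p i * M j k) := by
      rw [← Finset.sum_add_distrib]
      refine sum_congr rfl fun i _ => ?_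
      rw [← Finset.sum_add_distrib]
      refine sum_congr rfl fun j _ => ?_
      ring
    have e2 : ∑ i, ∑ j, C i j * (R i k * g j) = (fun i => R i k) ⬝ᵥ (C *ᵥ g) :=
      sum_sum_mul_mul_eq_dotProduct_mulVec C (fun i => R i k) g
    have e3 : ∑ i, ∑ j, C i j * (p i * M j k) = p ⬝ᵥ (C *ᵥ fun j => M j k) :=
      sum_sum_mul_mul_eq_dotProduct_mulVec C p (fun j => M j k)
    have e4 : (w ᵥ* R) k = (fun i => R i k) ⬝ᵥ w := by
      simp only [Matrix.vecMul, dotProduct]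
      refine sum_congr rfl fun i _ => ?_
      ring
    have e5 : (M *ᵥ (C *ᵥ p)) k = p ⬝ᵥ (C *ᵥ fun j => M j k) := by
      rw [dotProduct_mulVec_symm hCT]
      simp only [Matrix.mulVec, dotProduct]
      refine sum_congr rfl fun j _ => ?_
      rw [hMsym j k]; ring
    rw [e1, e2, e3, e4, e5, hw]
  -- scalar abbreviations
  set Θ : ℝ := ∑ k, w k * ∑ i, ∑ j, C i j * T k i j with hΘ
  set trCMCM : ℝ := Matrix.trace (C * (M * C * M)) with htrCMCM
  set μ : ℝ := (M *ᵥ w) ⬝ᵥ w with hμ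
  set π : ℝ := (M *ᵥ (C *ᵥ p)) ⬝ᵥ w with hπ
  set ρ : ℝ := w ⬝ᵥ (R *ᵥ w) with hρ
  set cdd : ℝ := g ⬝ᵥ (Cdd *ᵥ g) with hcdd
  set trCM : ℝ := Matrix.trace (C * M) with htrCM
  set pw : ℝ := p ⬝ᵥ w with hpw
  -- (8) the generator identity in scalar form
  have h1' : ud = (1 / 2) * trCM - pw := by
    rw [h1, sum_sum_mul_eq_trace_mul, sum_sum_mul_mul_eq_dotProduct_mulVec]
  -- (9) `Ad` in scalar form
  have hAd' : Ad = (Θ - 2 * ρ - 2 * π) + cdd := by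
    rw [hAd, hgdw, sum_sum_mul_mul_eq_dotProduct_mulVec]
    have e1 : gd ⬝ᵥ w = (1 / 2) * Θ - ρ - π := by
      have egd : gd = fun k => (1 / 2) * (∑ i, ∑ j, C i j * T k i j) -
          ((w ᵥ* R) k + (M *ᵥ (C *ᵥ p)) k) := funext hgd'
      rw [egd]
      simp only [dotProduct, sub_mul, add_mul, Finset.sum_sub_distrib, Finset.sum_add_distrib]
      have eΘ : ∑ k, (1 / 2) * (∑ i, ∑ j, C i j * T k i j) * w k = (1 / 2) * Θ := by
        rw [hΘ, Finset.mul_sum]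
        refine sum_congr rfl fun k _ => ?_
        ring
      have eρ : ∑ k, (w ᵥ* R) k * w k = ρ := by
        rw [hρ, Matrix.dotProduct_mulVec]; rfl
      have eπ : ∑ k, (M *ᵥ (C *ᵥ p)) k * w k = π := by rw [hπ]; rfl
      rw [eΘ, eρ, eπ]
      ring
    rw [e1]
    ring
  -- (10) the sums entering `L H`
  have hSgg : ∑ i, ∑ j, C i j * (g i * g j) = A := by
    rw [sum_sum_mul_mul_eq_dotProduct_mulVec, ← hw, ← hA']
  have hSU2 : ∑ i, ∑ j, C i j * U2 i j = trCM := by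
    simp only [hU2]
    rw [sum_sum_mul_eq_trace_mul]
  have hdAvec : dA = (2 : ℝ) • (M *ᵥ w) := by
    funext j; rw [hdA' j]; simp [Pi.smul_apply, smul_eq_mul]
  have hSdA1 : ∑ i, ∑ j, C i j * (g i * dA j) = 2 * μ := by
    rw [sum_sum_mul_mul_eq_dotProduct_mulVec, dotProduct_mulVec_symm hCT, ← hw, hdAvec,
      dotProduct_smul, smul_eq_mul, hμ, dotProduct_comm]
  have hSdA2 : ∑ i, ∑ j, C i j * (dA i * g j) = 2 * μ := by
    rw [sum_sum_mul_mul_eq_dotProduct_mulVec, ← hw, hdAvec, smul_dotProduct, smul_eq_mul, hμ]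
  have hSpg : ∑ i, ∑ j, C i j * (p i * g j) = pw := by
    rw [sum_sum_mul_mul_eq_dotProduct_mulVec]
  have hSd2A : ∑ i, ∑ j, C i j * d2A i j = 2 * Θ + 2 * trCMCM := by
    have h := hLA1
    linarith [h]
  -- (11) `L H` and `Ḣ` in scalar form
  have hu0 : u ≠ 0 := hu.ne'
  have eS1 : ∑ i, ∑ j, C i j * d2H i j =
      (1 / (4 * u)) * (∑ i, ∑ j, C i j * d2A i j) -
        (1 / (4 * u ^ 2)) * (∑ i, ∑ j, C i j * (g i * dA j)) -
        (1 / (4 * u ^ 2)) * (∑ i, ∑ j, C i j * (dA i * g j)) -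
        (A / (4 * u ^ 2)) * (∑ i, ∑ j, C i j * U2 i j) +
        (2 * A / (4 * u ^ 3)) * (∑ i, ∑ j, C i j * (g i * g j)) := by
    have e0 : ∀ i j, C i j * d2H i j =
        (1 / (4 * u)) * (C i j * d2A i j) - (1 / (4 * u ^ 2)) * (C i j * (g i * dA j)) -
          (1 / (4 * u ^ 2)) * (C i j * (dA i * g j)) - (A / (4 * u ^ 2)) * (C i j * U2 i j) +
          (2 * A / (4 * u ^ 3)) * (C i j * (g i * g j)) := by
      intro i j; rw [hd2H i j]; ring
    simp_rw [e0, Finset.sum_add_distrib, Finset.sum_sub_distrib, ← Finset.mul_sum]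
  have eS2 : ∑ i, ∑ j, C i j * (p i * dH j) =
      (1 / (4 * u)) * (∑ i, ∑ j, C i j * (p i * dA j)) -
        (A / (4 * u ^ 2)) * (∑ i, ∑ j, C i j * (p i * g j)) := by
    have e0 : ∀ i j, C i j * (p i * dH j) =
        (1 / (4 * u)) * (C i j * (p i * dA j)) - (A / (4 * u ^ 2)) * (C i j * (p i * g j)) := by
      intro i j; rw [hdH j]; ring
    simp_rw [e0, Finset.sum_sub_distrib, ← Finset.mul_sum]
  have eLH : LH = (Θ + trCMCM - 2 * π) / (4 * u) - 2 * μ / (4 * u ^ 2) - A * ud / (4 * u ^ 2) +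
      A ^ 2 / (4 * u ^ 3) := by
    rw [hLH, eS1, eS2, hSd2A, hSdA1, hSdA2, hSU2, hSgg, hpdA, hSpg, h1']
    field_simp
    ring
  have eHd : Hd = (Θ - 2 * ρ - 2 * π + cdd) / (4 * u) - A * ud / (4 * u ^ 2) := by
    rw [hHd, hAd']
  -- (12) the Frobenius term: `u² tr(CMCM) − 2uμ + A² = tr(C X C X) ≥ 0`, `X = uM − g⊗g`
  have hP : 0 ≤ u ^ 2 * trCMCM - 2 * u * μ + A ^ 2 := by
    set G : Matrix n n ℝ := Matrix.vecMulVec g g with hG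
    set X : Matrix n n ℝ := u • M - G with hX
    have hXsym : ∀ i j, X j i = X i j := by
      intro i j
      simp only [hX, hG, Matrix.sub_apply, Matrix.smul_apply, Matrix.vecMulVec_apply, smul_eq_mul]
      rw [hMsym i j, mul_comm (g j) (g i)]
    have h0 := trace_mul_mul_mul_self_nonneg hC hXsym
    -- the four traces
    have hCG : C * G = Matrix.vecMulVec w g := by rw [hG, Matrix.mul_vecMulVec]
    have hCGC : C * G * C = Matrix.vecMulVec w w := by
      rw [hCG, Matrix.vecMulVec_mul, hgC]
    have tG1 : Matrix.trace (C * M * C * G) = μ := by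
      rw [hG, Matrix.mul_vecMulVec, Matrix.trace_vecMulVec, ← Matrix.mulVec_mulVec,
        ← Matrix.mulVec_mulVec, ← hw, dotProduct_comm, dotProduct_mulVec_symm hCT, ← hw, hμ,
        dotProduct_comm]
    have tG2 : Matrix.trace (C * G * C * M) = μ := by
      rw [hCGC, Matrix.vecMulVec_mul, Matrix.trace_vecMulVec, vecMul_eq_mulVec_of_transpose_eq hMT,
        hμ, dotProduct_comm]
    have tG3 : Matrix.trace (C * G * C * G) = A ^ 2 := by
      rw [hCGC, hG, Matrix.vecMulVec_mul_vecMulVec, Matrix.trace_vecMulVec, dotProduct_smul,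
        smul_eq_mul, dotProduct_comm, ← hA', pow_two]
    have tMM : Matrix.trace (C * M * C * M) = trCMCM := by
      rw [htrCMCM, Matrix.mul_assoc, Matrix.mul_assoc, ← Matrix.mul_assoc M C M]
    have hexp : Matrix.trace (C * X * C * X) =
        u * (u * Matrix.trace (C * M * C * M) - Matrix.trace (C * G * C * M)) -
          (u * Matrix.trace (C * M * C * G) - Matrix.trace (C * G * C * G)) := by
      simp only [hX, Matrix.mul_sub, Matrix.sub_mul, Matrix.mul_smul, Matrix.smul_mul,
        Matrix.trace_sub, Matrix.trace_smul, smul_eq_mul, smul_sub]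
      ring
    rw [hexp, tMM, tG1, tG2, tG3] at h0
    have e : u * (u * trCMCM - μ) - (u * μ - A ^ 2) = u ^ 2 * trCMCM - 2 * u * μ + A ^ 2 := by ring
    rwa [e] at h0
  -- (13) conclusion
  have hkey : LH - Hd - 2 * lam * H =
      (2 * ρ - cdd - 2 * lam * A) / (4 * u) + (u ^ 2 * trCMCM - 2 * u * μ + A ^ 2) / (4 * u ^ 3) := by
    rw [eLH, eHd, hH]
    field_simp
    ring
  have hms' : 0 ≤ 2 * ρ - cdd - 2 * lam * A := by
    rw [hA']
    linarith [hms]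
  have h4u : 0 < 4 * u := by positivity
  have h4u3 : 0 < 4 * u ^ 3 := by positivity
  have : 0 ≤ LH - Hd - 2 * lam * H := by
    rw [hkey]
    exact add_nonneg (div_nonneg hms' h4u.le) (div_nonneg hP h4u3.le)
  linarith

/-! ### Antisymmetric summands against a symmetric matrix -/

/-- `Σ_{ij} C_{ij} a_{ij} = 0` for `C` symmetric and `a` antisymmetric. [folklore] -/
private theorem sum_sum_mul_eq_zero_of_antisymm {C : Matrix n n ℝ} (hC : ∀ i j, C j i = C i j)
    {a : n → n → ℝ} (ha : ∀ i j, a j i = -a i j) : ∑ i, ∑ j, C i j * a i j = 0 := by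
  have h : ∑ i, ∑ j, C i j * a i j = ∑ i, ∑ j, C j i * a j i := Finset.sum_comm
  have h' : ∑ i, ∑ j, C j i * a j i = -∑ i, ∑ j, C i j * a i j := by
    rw [← Finset.sum_neg_distrib]
    refine sum_congr rfl fun i _ => ?_
    rw [← Finset.sum_neg_distrib]
    refine sum_congr rfl fun j _ => ?_
    rw [hC i j, ha i j]; ring
  linarith

/-! ### The generator identities for the quotient `u = W/Z` in terms of smoothed jets

With `Z = E_{C_t}[e^{−V₀}(y+ζ)]`, `W = E_{C_t}[e^{−V₀}F(y+ζ)]` and their spatial jets `Z_i = ∂_iZ`,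
`Z_{ij}`, `Z_{ijk}`, `W_i`, `W_{ij}`, `W_{ijk}` (Gaussian averages of the corresponding derivatives of the
integrands), [BBD] Prop 5 gives the time derivatives `Ż = ½Σ Ċ_{ab}Z_{ab}`, `Ẇ = ½Σ Ċ_{ab}W_{ab}`,
`Ż_k = ½Σ Ċ_{ab}Z_{abk}`, `Ẇ_k = ½Σ Ċ_{ab}W_{abk}`; `F_t = P_{0,t}F = W/Z` ([BBD] proof of Prop 8,
p0015 L9–12), `∇V_t = −∇Z/Z`.  The two lemmas below are the generator identity
`∂_tF_t = L_tF_t` (the displayed computation p0015 L19–32) and its spatial gradient, as identities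
between rational expressions in the jets. -/

/-- **The generator identity `∂_t(W/Z) = L_t(W/Z)` in jet form** ([BBD] Prop 8, proof p0015 L19–32:
«`∂_tF_{s,t} = … = ½Δ_{Ċ_t}F_{s,t} − (∇V_t, ∇F_{s,t})_{Ċ_t}`»).
[cite: BauerschmidtBodineauDagallier2023, Proposition 8 (proof)] -/
theorem jet_generator {C : Matrix n n ℝ} (hC : ∀ i j, C j i = C i j) {Z W Zd Wd ud : ℝ}
    (hZ : Z ≠ 0) {Z1 W1 g p : n → ℝ} {Z2 W2 N : n → n → ℝ}
    (hZ2 : ∀ i j, Z2 j i = Z2 i j) (hW2 : ∀ i j, W2 j i = W2 i j)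
    (hg : ∀ k, g k = W1 k / Z - W * Z1 k / Z ^ 2) (hp : ∀ i, p i = -Z1 i / Z)
    (hN : ∀ i j, N i j = W2 i j / Z - W1 j * Z1 i / Z ^ 2 - W1 i * Z1 j / Z ^ 2 - W * Z2 i j / Z ^ 2 +
      2 * W * Z1 j * Z1 i / Z ^ 3)
    (hZd : Zd = (1 / 2) * ∑ a, ∑ b, C a b * Z2 a b) (hWd : Wd = (1 / 2) * ∑ a, ∑ b, C a b * W2 a b)
    (hud : ud = Wd / Z - W * Zd / Z ^ 2) :
    ud = (1 / 2) * (∑ i, ∑ j, C i j * N i j) - ∑ i, ∑ j, C i j * (p i * g j) := by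
  -- both sides as `Σ C_{ij}(·)`
  have eL : ud = ∑ i, ∑ j, C i j * ((1 / 2) * W2 i j / Z - (1 / 2) * W * Z2 i j / Z ^ 2) := by
    rw [hud, hWd, hZd]
    simp only [Finset.mul_sum, Finset.sum_div, ← Finset.sum_sub_distrib]
    refine sum_congr rfl fun i _ => sum_congr rfl fun j _ => ?_
    ring
  have eR : (1 / 2) * (∑ i, ∑ j, C i j * N i j) - ∑ i, ∑ j, C i j * (p i * g j) =
      ∑ i, ∑ j, C i j * ((1 / 2) * N i j - p i * g j) := by
    simp only [Finset.mul_sum, ← Finset.sum_sub_distrib]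
    refine sum_congr rfl fun i _ => sum_congr rfl fun j _ => ?_
    ring
  rw [eL, eR, ← sub_eq_zero, ← Finset.sum_sub_distrib]
  simp only [← Finset.sum_sub_distrib, ← mul_sub]
  refine sum_sum_mul_eq_zero_of_antisymm hC fun i j => ?_
  rw [hN i j, hN j i, hp i, hp j, hg i, hg j, hZ2 i j, hW2 i j]
  field_simp
  ring

/-- **The gradient of the generator identity, `∂_t∂_k(W/Z) = ∂_k L_t(W/Z)`, in jet form**: with
`g_k = ∂_k(W/Z)`, `M_{jk} = ∂_k g_j`, `T_{kij} = ∂_i∂_j g_k`, `p = ∇V_t = −∇Z/Z`, `R_{ik} = ∂_k p_i`,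
the time derivative `ġ_k` (from Prop 5 applied to the jets) equals
`½Σ Ċ_{ij}T_{kij} − Σ Ċ_{ij}(R_{ik} g_j + p_i M_{jk})` ([BBD] Prop 8 differentiated in space; this is
the input of Lemma 1, «`∂_t` of `(∇P_{0,t}F)²_Q`», p0017 L24–28).
[cite: BauerschmidtBodineauDagallier2023, Proposition 8 (proof)] -/
theorem jet_gradient_generator {C : Matrix n n ℝ} (hC : ∀ i j, C j i = C i j) {Z W Zd Wd : ℝ}
    (hZ : Z ≠ 0) {Z1 W1 g p Z1d W1d gd : n → ℝ} {Z2 W2 M R : n → n → ℝ} {Z3 W3 T : n → n → n → ℝ}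
    (hZ2 : ∀ i j, Z2 j i = Z2 i j) (hW2 : ∀ i j, W2 j i = W2 i j)
    (hg : ∀ k, g k = W1 k / Z - W * Z1 k / Z ^ 2) (hp : ∀ i, p i = -Z1 i / Z)
    (hM : ∀ j k, M j k = W2 k j / Z - W1 j * Z1 k / Z ^ 2 - W1 k * Z1 j / Z ^ 2 - W * Z2 k j / Z ^ 2 +
      2 * W * Z1 j * Z1 k / Z ^ 3)
    (hR : ∀ i k, R i k = -Z2 k i / Z + Z1 i * Z1 k / Z ^ 2)
    (hT : ∀ k i j, T k i j = W3 i j k / Z - W2 j k * Z1 i / Z ^ 2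
      - (W2 i k * Z1 j + W1 k * Z2 i j) / Z ^ 2 + 2 * W1 k * Z1 j * Z1 i / Z ^ 3
      - (W2 i j * Z1 k + W1 j * Z2 i k) / Z ^ 2 + 2 * W1 j * Z1 k * Z1 i / Z ^ 3
      - (W1 i * Z2 j k + W * Z3 i j k) / Z ^ 2 + 2 * W * Z2 j k * Z1 i / Z ^ 3
      + 2 * (W1 i * Z1 k * Z1 j + W * Z2 i k * Z1 j + W * Z1 k * Z2 i j) / Z ^ 3
      - 6 * W * Z1 k * Z1 j * Z1 i / Z ^ 4)
    (hZd : Zd = (1 / 2) * ∑ a, ∑ b, C a b * Z2 a b) (hWd : Wd = (1 / 2) * ∑ a, ∑ b, C a b * W2 a b)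
    (hZ1d : ∀ k, Z1d k = (1 / 2) * ∑ a, ∑ b, C a b * Z3 a b k)
    (hW1d : ∀ k, W1d k = (1 / 2) * ∑ a, ∑ b, C a b * W3 a b k)
    (hgd : ∀ k, gd k = W1d k / Z - W1 k * Zd / Z ^ 2 - Wd * Z1 k / Z ^ 2 - W * Z1d k / Z ^ 2 +
      2 * W * Z1 k * Zd / Z ^ 3) (k : n) :
    gd k = (1 / 2) * (∑ i, ∑ j, C i j * T k i j) -
      ∑ i, ∑ j, C i j * (R i k * g j + p i * M j k) := by
  have eL : gd k = ∑ i, ∑ j, C i j * ((1 / 2) * (W3 i j k / Z - W1 k * Z2 i j / Z ^ 2 -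
      W2 i j * Z1 k / Z ^ 2 - W * Z3 i j k / Z ^ 2 + 2 * W * Z1 k * Z2 i j / Z ^ 3)) := by
    rw [hgd k, hW1d k, hZ1d k, hWd, hZd]
    simp only [Finset.mul_sum, Finset.sum_mul, Finset.sum_div, ← Finset.sum_sub_distrib,
      ← Finset.sum_add_distrib]
    refine sum_congr rfl fun i _ => sum_congr rfl fun j _ => ?_
    ring
  have eR : (1 / 2) * (∑ i, ∑ j, C i j * T k i j) - ∑ i, ∑ j, C i j * (R i k * g j + p i * M j k) =
      ∑ i, ∑ j, C i j * ((1 / 2) * T k i j - (R i k * g j + p i * M j k)) := by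
    simp only [Finset.mul_sum, ← Finset.sum_sub_distrib]
    refine sum_congr rfl fun i _ => sum_congr rfl fun j _ => ?_
    ring
  rw [eL, eR, ← sub_eq_zero, ← Finset.sum_sub_distrib]
  simp only [← Finset.sum_sub_distrib, ← mul_sub]
  refine sum_sum_mul_eq_zero_of_antisymm hC fun i j => ?_
  rw [hT k i j, hT k j i, hR i k, hR j k, hp i, hp j, hg i, hg j, hM j k, hM i k,
    hZ2 i j, hW2 i j, hZ2 i k, hZ2 j k, hW2 i k, hW2 j k]
  field_simp
  ring

end Polchinski

end Literature.Analysis.FunctionSpaces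

end
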